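import Literature.NumberTheory.EllipticCurves.DivisionFieldReducibleBorelKernel
import Mathlib.GroupTheory.PGroup
import HarnessLib

/-!
# Stub `stub_divisionTowerTwoFour` of line `resolvent-elliptic-units` of the crux `SignedMuSeedAtTwoPlus`
# (stmt-BirchSwinnertonDyer-21438 = `stub_residualSeedAtTwo` of Kμ⁺ stmt-BirchSwinnertonDyer-20689 BY NAME,
# route `ResidualThetaTransportAtTwo`) — PROVED: `ℚ(W[2]) ≤ ℚ(W[4])` with `2`-power index
# (width seat bsd-wall-rtt-p4-w3 g6; `--supports stmt-BirchSwinnertonDyer-21438`; closes nothing)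

HONEST FRAMING. THEOREMS ONLY (no `def`, no named fact, no `sorry`); BSD is not proved by any of this. The file proves the
registered stub `stub_divisionTowerTwoFour : DivisionTowerTwoFour` of `Cruxes/SignedMuSeedAtTwoPlus/Lines/resolvent_elliptic_units.lean`
(skeleton of record of 21438, sha acdb2e2ad61c) with the line's local `def DivisionTowerTwoFour` UNFOLDED verbatim, as the
`(p, m, n) = (2, 2, 4)` instance of two general facts about division fields of an elliptic curve over a field of characteristic `0`:

* `§1` `divisionField_mono` — `m ∣ n ⇒ K(E[m]) ≤ K(E[n])` (`Γ_{K(E[n])} ≤ Γ_{K(E[m])}`: an automorphism fixing `E[n]` pointwise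
  fixes `E[m] ⊆ E[n]`).
* `§2` `exists_finrank_divisionField_eq_prime_pow_mul` — for a prime `p` with `p ∣ m`, `m ∣ n`, `n ∣ m·p`:
  `[K(E[n]) : K] = p^k · [K(E[m]) : K]`. Mechanism (Serre 1972 §IV / *AEC* III.§7: the kernel of `GL₂(ℤ/n) → GL₂(ℤ/m)` is a
  `p`-group): for `σ ∈ Γ_{K(E[m])}` and `Q ∈ E[n]`, `R = σQ − Q` lies in `E[m]` (as `mQ ∈ E[p] ⊆ E[m]` is fixed), so `σR = R` and
  `σ ↦ (Q ↦ σQ − Q)` is a HOMOMORPHISM `Γ_{K(E[m])} → (E[n] → E[n])` with kernel `Γ_{K(E[n])}` whose image is killed by `p`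
  (`pR = σ(pQ) − pQ = 0`, `pQ ∈ E[m]`); hence `[Γ_{K(E[m])} : Γ_{K(E[n])}]` is the order of a finite group of exponent `p`, a power
  of `p` (`IsPGroup.iff_card`), and `[K(E[n]) : K] = [Γ_K : Γ_{K(E[n])}]` (`finrank_divisionField`, Krull).
* `§3` `divisionTowerTwoFour` — the stub VERBATIM.

References: [Serre1972] §IV; [SilvermanAEC2009] III.§7, VIII.§1; [LiTianYanZhu2025] §7 (p. 16: `F₀ = F(E_4)` at `p = 2`).
-/

set_option autoImplicit false
-- D-0017: single-problem summit, so `Summit.BirchSwinnertonDyer.BirchSwinnertonDyer.…` repeats a namespace BY DESIGN.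
set_option linter.dupNamespace false

noncomputable section

open scoped Classical

open WeierstrassCurve Field Literature.NumberTheory.EllipticCurves Literature.NumberTheory.GaloisRepresentations

namespace Summit.BirchSwinnertonDyer.BirchSwinnertonDyer.Theorems.SignedMuAtTwo.ResolventEllipticUnits

universe u

variable {K : Type u} [Field K] (W : WeierstrassCurve K)

/-! ## §1. `K(E[m]) ≤ K(E[n])` for `m ∣ n` -/

/-- An `m`-torsion point is an `n`-torsion point for `m ∣ n` (same underlying geometric point). [folklore] -/
theorem coe_mem_geomTorsion_of_dvd {m n : ℕ} (h : m ∣ n) (T : geomTorsion W (m : ℤ)) :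
    (T : geomPoints W) ∈ geomTorsion W (n : ℤ) := by
  obtain ⟨d, rfl⟩ := h
  have hT : m • (T : geomPoints W) = 0 := AddSubgroup.torsionBy.nsmul_iff.mp T.2
  exact AddSubgroup.torsionBy.nsmul_iff.mpr (by rw [mul_nsmul, hT, nsmul_zero])

/-- `Γ_{K(E[n])} ≤ Γ_{K(E[m])}` for `m ∣ n`: fixing `E[n]` pointwise fixes `E[m] ⊆ E[n]`. [cite: SilvermanAEC2009, VIII.§1 (the field K(E[m]))] -/
theorem fixingSubgroupOfModule_geomTorsion_anti {m n : ℕ} (h : m ∣ n) :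
    fixingSubgroupOfModule K (geomTorsion W (n : ℤ)) ≤ fixingSubgroupOfModule K (geomTorsion W (m : ℤ)) := by
  intro σ hσ
  rw [mem_fixingSubgroupOfModule_geomTorsion_iff] at hσ ⊢
  intro T
  have h1 := hσ ⟨(T : geomPoints W), coe_mem_geomTorsion_of_dvd W h T⟩
  apply Subtype.ext
  simpa using congrArg Subtype.val h1

/-- **`K(E[m]) ≤ K(E[n])` for `m ∣ n`** (any field `K`, any Weierstrass curve). [cite: SilvermanAEC2009, VIII.§1 (the field K(E[m]))] -/
theorem divisionField_mono {m n : ℕ} (h : m ∣ n) : W.divisionField m ≤ W.divisionField n :=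
  IntermediateField.fixedField_le (fixingSubgroupOfModule_geomTorsion_anti W h)

/-! ## §2. `[K(E[n]) : K(E[m])]` is a power of `p` when `p ∣ m ∣ n ∣ m p` -/

/-- For `σ ∈ Γ_{K(E[m])}`, `p ∣ m`, `n ∣ m·p` and `Q ∈ E[n]`: the point `R = σQ − Q` is fixed by every `τ ∈ Γ_{K(E[m])}`
(`mR = 0` since `mQ ∈ E[p] ⊆ E[m]` is fixed, so `R ∈ E[m]`). [cite: Serre1972, §IV] -/
theorem smul_sub_smul_eq_of_mem_fixing {p m n : ℕ} (hpm : p ∣ m) (hnmp : n ∣ m * p)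
    {σ τ : absoluteGaloisGroup K} (hσ : σ ∈ fixingSubgroupOfModule K (geomTorsion W (m : ℤ)))
    (hτ : τ ∈ fixingSubgroupOfModule K (geomTorsion W (m : ℤ))) (Q : geomTorsion W (n : ℤ)) :
    τ • (σ • Q - Q) = σ • Q - Q := by
  rw [mem_fixingSubgroupOfModule_geomTorsion_iff] at hσ hτ
  -- `m • Q` is an `m`-torsion point (indeed `p`-torsion), hence fixed by `σ`
  have hnQ : n • (Q : geomPoints W) = 0 := AddSubgroup.torsionBy.nsmul_iff.mp Q.2
  have hmQ_mem : m • (Q : geomPoints W) ∈ geomTorsion W (m : ℤ) := by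
    refine AddSubgroup.torsionBy.nsmul_iff.mpr ?_
    -- `m • m • Q = (m*m) • Q` and `n ∣ m * p ∣ m * m`
    have hdvd : n ∣ m * m := hnmp.trans (mul_dvd_mul_left m hpm)
    obtain ⟨c, hc⟩ := hdvd
    rw [← mul_nsmul, hc, mul_nsmul, hnQ, nsmul_zero]
  have hσmQ : σ • (m • (Q : geomPoints W)) = m • (Q : geomPoints W) := by
    simpa using congrArg Subtype.val (hσ ⟨m • (Q : geomPoints W), hmQ_mem⟩)
  -- hence `R = σQ − Q` is `m`-torsion
  have hR_mem : ((σ • Q - Q : geomTorsion W (n : ℤ)) : geomPoints W) ∈ geomTorsion W (m : ℤ) := by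
    refine AddSubgroup.torsionBy.nsmul_iff.mpr ?_
    rw [AddSubgroupClass.coe_sub, AddSubgroup.torsionBy.coe_smul, nsmul_sub, ← smul_comm σ m, hσmQ, sub_self]
  -- and is fixed by `τ`
  apply Subtype.ext
  simpa using congrArg Subtype.val (hτ ⟨_, hR_mem⟩)

/-- **`[K(E[n]) : K] = p^k · [K(E[m]) : K]` for a prime `p` with `p ∣ m`, `m ∣ n`, `n ∣ m·p`** (`E` elliptic over a field of
characteristic `0`): `σ ↦ (Q ↦ σQ − Q)` is a homomorphism on `Γ_{K(E[m])}` with kernel `Γ_{K(E[n])}` into a group killed by `p`,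
so `[Γ_{K(E[m])} : Γ_{K(E[n])}]` is a power of `p`; and `[K(E[·]) : K] = [Γ_K : Γ_{K(E[·])}]` (Krull). The kernel of
`GL₂(ℤ/n) → GL₂(ℤ/m)` is a `p`-group. [cite: Serre1972, §IV] [cite: SilvermanAEC2009, III.§7 and VIII.§1] -/
theorem exists_finrank_divisionField_eq_prime_pow_mul [CharZero K] [W.IsElliptic] {p m n : ℕ} [hp : Fact p.Prime]
    (hpm : p ∣ m) (hmn : m ∣ n) (hnmp : n ∣ m * p) (hn : n ≠ 0) :
    ∃ k : ℕ, Module.finrank K (W.divisionField n) = p ^ k * Module.finrank K (W.divisionField m) := by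
  have hm : m ≠ 0 := fun h ↦ hn (Nat.eq_zero_of_zero_dvd (h ▸ hmn))
  haveI : NeZero n := ⟨hn⟩
  haveI : NeZero m := ⟨hm⟩
  haveI : Finite (geomTorsion W (n : ℤ)) := W.finite_geomTorsion_nat hn
  set Γm := fixingSubgroupOfModule K (geomTorsion W (m : ℤ)) with hΓm
  set Γn := fixingSubgroupOfModule K (geomTorsion W (n : ℤ)) with hΓn
  have hle : Γn ≤ Γm := fixingSubgroupOfModule_geomTorsion_anti W hmn
  -- the homomorphism `σ ↦ (Q ↦ σQ − Q)` on `Γ_{K(E[m])}`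
  let φ : ↥Γm →* Multiplicative (geomTorsion W (n : ℤ) → geomTorsion W (n : ℤ)) :=
    { toFun := fun σ ↦ Multiplicative.ofAdd fun Q ↦ (σ : absoluteGaloisGroup K) • Q - Q
      map_one' := by
        rw [← ofAdd_zero]
        congr 1
        funext Q
        rw [Subgroup.coe_one, one_smul, sub_self, Pi.zero_apply]
      map_mul' := fun σ τ ↦ by
        rw [← ofAdd_add]
        congr 1
        funext Q
        rw [Pi.add_apply, Subgroup.coe_mul, mul_smul]
        have hfix := smul_sub_smul_eq_of_mem_fixing W hpm hnmp τ.2 σ.2 Q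
        calc (σ : absoluteGaloisGroup K) • (τ : absoluteGaloisGroup K) • Q - Q
            = (σ : absoluteGaloisGroup K) • ((τ : absoluteGaloisGroup K) • Q - Q) +
                ((σ : absoluteGaloisGroup K) • Q - Q) := by rw [smul_sub]; abel
          _ = ((τ : absoluteGaloisGroup K) • Q - Q) + ((σ : absoluteGaloisGroup K) • Q - Q) := by rw [hfix]
          _ = ((σ : absoluteGaloisGroup K) • Q - Q) + ((τ : absoluteGaloisGroup K) • Q - Q) := add_comm _ _ }
  have hφ_apply : ∀ σ : ↥Γm, φ σ = Multiplicative.ofAdd fun Q ↦ (σ : absoluteGaloisGroup K) • Q - Q := fun _ ↦ rfl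
  -- its kernel is `Γ_{K(E[n])}`
  have hker : φ.ker = Γn.subgroupOf Γm := by
    ext σ
    rw [MonoidHom.mem_ker, Subgroup.mem_subgroupOf, hΓn, mem_fixingSubgroupOfModule_geomTorsion_iff, hφ_apply,
      ← ofAdd_zero, Multiplicative.ofAdd.apply_eq_iff_eq, funext_iff]
    simp only [Pi.zero_apply, sub_eq_zero]
  -- its image is killed by `p`
  have hexp : ∀ g : ↥φ.range, g ^ p = 1 := by
    intro g
    obtain ⟨σ, hσ⟩ := MonoidHom.mem_range.mp g.2
    apply Subtype.ext
    rw [Subgroup.coe_pow, Subgroup.coe_one, ← hσ, hφ_apply, ← ofAdd_nsmul, ← ofAdd_zero]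
    congr 1
    funext Q
    rw [Pi.smul_apply, Pi.zero_apply, smul_sub]
    -- `p • σQ − p • Q = σ(pQ) − pQ = 0` since `pQ ∈ E[m]`
    have hpQ_mem : p • (Q : geomPoints W) ∈ geomTorsion W (m : ℤ) := by
      refine AddSubgroup.torsionBy.nsmul_iff.mpr ?_
      obtain ⟨c, hc⟩ := hnmp
      rw [← mul_nsmul, mul_comm p m, hc, mul_nsmul, AddSubgroup.torsionBy.nsmul_iff.mp Q.2, nsmul_zero]
    have h1 := (W.mem_fixingSubgroupOfModule_geomTorsion_iff m).mp σ.2 ⟨p • (Q : geomPoints W), hpQ_mem⟩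
    have h2 : (σ : absoluteGaloisGroup K) • (p • (Q : geomPoints W)) = p • (Q : geomPoints W) := by
      simpa using congrArg Subtype.val h1
    apply Subtype.ext
    rw [ZeroMemClass.coe_zero, AddSubgroupClass.coe_sub, AddSubgroupClass.coe_nsmul, AddSubgroupClass.coe_nsmul,
      AddSubgroup.torsionBy.coe_smul, ← smul_comm (σ : absoluteGaloisGroup K) p, h2, sub_self]
  -- hence a `p`-group, of order `p^k`
  have hP : IsPGroup p ↥φ.range := fun g ↦ ⟨1, by rw [pow_one]; exact hexp g⟩
  obtain ⟨k, hk⟩ := IsPGroup.iff_card.mp hP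
  refine ⟨k, ?_⟩
  have hrel : Γn.relIndex Γm = p ^ k := by
    rw [Subgroup.relIndex, ← hker, Subgroup.index_ker, hk]
  rw [finrank_divisionField, finrank_divisionField, ← Subgroup.relIndex_mul_index hle, hrel]

/-! ## §3. The registered stub `stub_divisionTowerTwoFour` of line `resolvent-elliptic-units` -/

/-- **`DivisionTowerTwoFour`** (= `stub_divisionTowerTwoFour` of `Cruxes/SignedMuSeedAtTwoPlus/Lines/resolvent_elliptic_units.lean`, the
line's `def DivisionTowerTwoFour` unfolded verbatim): for every elliptic `W/ℚ`, `ℚ(W[2]) ≤ ℚ(W[4])` and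
`[ℚ(W[4]) : ℚ] = 2^k · [ℚ(W[2]) : ℚ]` (the kernel of `GL₂(ℤ/4) → GL₂(ℤ/2)` is a `2`-group). §1 with `2 ∣ 4`; §2 with
`(p, m, n) = (2, 2, 4)`. [cite: Serre1972, §IV] [cite: SilvermanAEC2009, III.§7 and VIII.§1] -/
theorem divisionTowerTwoFour :
    ∀ (W : WeierstrassCurve ℚ) [W.IsElliptic],
      W.divisionField 2 ≤ W.divisionField 4 ∧
        ∃ k : ℕ, Module.finrank ℚ (W.divisionField 4) = 2 ^ k * Module.finrank ℚ (W.divisionField 2) := by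
  intro W _
  exact ⟨divisionField_mono W (by norm_num),
    exists_finrank_divisionField_eq_prime_pow_mul W (p := 2) (m := 2) (n := 4) (dvd_refl 2) (by norm_num) (by norm_num)
      (by norm_num)⟩

end Summit.BirchSwinnertonDyer.BirchSwinnertonDyer.Theorems.SignedMuAtTwo.ResolventEllipticUnits

end
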